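/-
Copyright: the b2b-balaban T⁴-continuum CRUX team, row NE7b OWNER lineage `t4-ne7b-p1` (gen 136). Project licence.
-/
import Summits.QuantumFields.BalabanUV.T4Continuum.Spine.NE7b.SupGaussianQuadraticAbsorption
import Summits.QuantumFields.BalabanUV.T4Continuum.Spine.NE7b.SupDressedCovarianceLetters
import Summits.QuantumFields.BalabanUV.T4Continuum.Spine.NE7b.SupExtractedPartsIdentified

/-!
# THE DRESSED STEP — (α4)'s ENTRY ASSEMBLED: integrating the next single-block factor `Z(ψ₀ + ζ)` against the NEXT fluctuation Gaussian
# `N(0,S)` in `ζ` IS, for EVERY test functional `F` and ANY extracted data (vector `b`, matrix `K` with `S⁻¹ + K ≻ 0`), an integral of the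
# RESIDUAL factor `e^{r(ζ)}` against the DRESSED, SHIFTED Gaussian:
#   `∫ Z(ψ₀+ζ)·F(ζ) N(0,S)(dζ) = Z(ψ₀) · c · ∫ e^{r(ζ)}·F(ζ) N(−(S⁻¹+K)⁻¹b, (S⁻¹+K)⁻¹)(dζ)`,
#   `c = ∫ e^{−½ζᵀKζ − ⟨b,ζ⟩} N(0,S)(dζ) > 0`  (ONE NUMBER),   `r(ζ) = log Z(ψ₀+ζ) − log Z(ψ₀) + ⟨b,ζ⟩ + ½ζᵀKζ`;
# for THE ROAD'S CHOICE `b = b_D(ψ₀)`, `K = K_D(ψ₀)` ((388): gradient vector and Hessian matrix of the next potential) the residual `r` carries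
# the CUBIC letter of (389) and the hypothesis `S⁻¹ + K_D ≻ 0` IS DISCHARGED by (387)+(388) under the smallness `2λ_wγ′ < 1` of the
# remainders' lower second-order constant against the next covariance's letter `S ⪯ γ′·1` (`road_dressed_precision_posDef`).  The constant
# (vacuum energy), the linear part (mean shift) and the quadratic part (covariance dressing) have LEFT the polymer road; what re-enters it is
# `e^{r}` with (384)'s two letters (row NE7b, node U5c; (385)∕(386)∕(387)∕(388)∕(389) BY NAME; [folklore])

Cell `pub-balaban`, sub-cell `t4`, spine estimate NE7b (`T4WeightBudget.RelWeightBound`; the cell's OWN estimate — NOT PRINTED in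
[Bałaban 1983–89], NOT PROVED).  Crux-route work under `Spine/NE7b/` by the row OWNER (`t4-ne7b-p1` gen 136, file (390)) under FREEZE
(0)'s crux-prover clause, on gen 135's SCOPING-d7 DECISION (d7′)(2′) («extraction + absorption — then CONTRACTION, the RG proper»);
NOTHING of Bałaban's is named as a Lean object, valued or asserted; no `T4Continuum/Support` leaf typed; no `def`, no notation; zero `sorry`.
Imports (BY NAME): the OWNER's (385) `…SupGaussianQuadraticAbsorption` (`absorption_integral_neg`, `absorption_const_cov`), (387)
`…SupDressedCovarianceLetters` (`dressed_precision_posDef`), (389) `…SupExtractedPartsIdentified` and through it (386)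
(`factorisation_of_logs`), (388) (`nextHessianMatrix_letters`), (337b) (`lineZ_pos`), (313) (`mul_opBound_le_of_le`).

WHAT IS PROVED ([folklore]; `Y = ⋃_{p∈C} cell p`, `Z(ψ) = ∫e^{−Σ_Y w_x(ω_x+ψ_x)}dN(0,Γ)`):
* §1 `Z_pos_at`, `Z_pos_shifted`, **`next_factor_factorisation`** (for EVERY `ζ, b, K`: `Z(ψ₀+ζ) = Z(ψ₀)·(e^{−½ζᵀKζ − ⟨b,ζ⟩}·e^{r(ζ)})`);
* §2 THE END **`dressed_step`** (the display, for EVERY `F : ℝ^ι → G`), `dressed_step_const` (`c > 0` and its closed form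
  `√(det S⁻¹∕det(S⁻¹+K))·e^{½bᵀ(S⁻¹+K)⁻¹b}`);
* §3 THE ROAD'S CHOICE **`road_dressed_precision_posDef`**: under (388)'s hypotheses (over `N(0,M⁻¹)`) and a next covariance `S ≻ 0`,
  `S ⪯ γ′·1`, `0 < γ′`, `2λ_wγ′ < 1`:  `S⁻¹ + K_D(ψ₀) ≻ 0` — `dressed_step`'s hypothesis for `K = K_D(ψ₀)`; §4 toy.

HONEST (what this is NOT).  An exact identity plus one discharged positivity: `r`'s cubic letter holds on the road's small fields only
((389)∕(339)) and its constant `C₃` is NOT shown to contract — that, with the blocking∕rescaling of (352)–(370), is the renormalisation group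
proper and remains LOCATED, not done; the dressed covariance has no finite-range letter here (decay: the dressed column (233)–(256)); scalar
skeleton ((A3), NC-NE7b-α UNRULED); nothing of Bałaban's asserted.  BY-NAME EFFECT ON THE WALL: NONE.  NE7b NOT PRINTED ∕ NOT PROVED; spine
PROVED 0∕9; rung (B)+1 — the programme's measures remain FINITE-torus statements; NOT the mass gap, NOT Clay.  HONEST DEPENDENCY: continuum YM
on T⁴ ⇐ BetaPertH ∧ nine spine estimates (0∕9 proved); BetaPertH ⇐ (D1) ∧ (D4) ∧ CAP+tail; G-an2-4 gates asym, D1 and NE2∕3∕4.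
-/

set_option autoImplicit false
set_option maxSynthPendingDepth 2

noncomputable section

namespace Summit.QuantumFields.BalabanUV.T4Continuum.NE7b.SupDressedStep

open MeasureTheory ProbabilityTheory Finset Real Matrix
open scoped BigOperators
open SupGaussianQuadraticAbsorption (absorption_integral_neg absorption_const_cov)
open SupDressedCovarianceLetters (dressed_precision_posDef)
open SupQuadraticExtractionLine (factorisation_of_logs)
open SupNextHessianMatrix (nextHessianMatrix_letters)
open SupNextPotentialThirdLetter (lineZ_pos)
open SupEffectiveActionDerivative (mul_opBound_le_of_le)

variable {ι : Type} [Fintype ι] [DecidableEq ι] {V : Type*}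

section Road

variable {Γ : Matrix ι ι ℝ} {γop : ℝ} {cell : V → Finset ι} {w w' w'' : ι → ℝ → ℝ} {κ₀ κ₁ κ₂ τ δ θ : ℝ}

/-! ## §1. Positivity and the exact factorisation of the next factor -/

/-- `Z(ψ₀) > 0`. [folklore] -/
theorem Z_pos_at (hΓ : Γ.PosSemidef) (hΓop : (γop • (1 : Matrix ι ι ℝ) - Γ).PosSemidef) (hw : ∀ x, Measurable (w x))
    (hκ₀ : 0 ≤ κ₀) (hτ : 0 < τ) (hδ : 0 < δ) (hθ0 : 0 < θ) (hθ1 : θ < 1) (hκθ : (2 * κ₀ * (1 + τ) + 4 * δ) * γop ≤ θ)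
    (hstab : ∀ x, ∀ t : ℝ, -(κ₀ * t ^ 2) ≤ w x t) (C : Finset V) (ψ₀ : EuclideanSpace ℝ ι) :
    0 < (∫ ω : EuclideanSpace ℝ ι, exp (-(∑ x ∈ C.biUnion cell, w x (ω x + ψ₀ x))) ∂(multivariateGaussian 0 Γ)) := by
  have hκθ₀ : 2 * κ₀ * (1 + τ) * γop ≤ θ := mul_opBound_le_of_le (by positivity) (by linarith) hθ0.le hκθ
  have h := (lineZ_pos hΓ hΓop (C.biUnion cell) hw hκ₀ hτ hθ1 hκθ₀ hstab (WithLp.ofLp ψ₀) (WithLp.ofLp ψ₀) 0).2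
  simpa only [zero_mul, add_zero] using h

/-- `Z(ψ₀ + ζ) > 0` for every `ζ`. [folklore] -/
theorem Z_pos_shifted (hΓ : Γ.PosSemidef) (hΓop : (γop • (1 : Matrix ι ι ℝ) - Γ).PosSemidef) (hw : ∀ x, Measurable (w x))
    (hκ₀ : 0 ≤ κ₀) (hτ : 0 < τ) (hδ : 0 < δ) (hθ0 : 0 < θ) (hθ1 : θ < 1) (hκθ : (2 * κ₀ * (1 + τ) + 4 * δ) * γop ≤ θ)
    (hstab : ∀ x, ∀ t : ℝ, -(κ₀ * t ^ 2) ≤ w x t) (C : Finset V) (ψ₀ ζ : EuclideanSpace ℝ ι) :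
    0 < (∫ ω : EuclideanSpace ℝ ι, exp (-(∑ x ∈ C.biUnion cell, w x (ω x + (ψ₀ x + ζ x)))) ∂(multivariateGaussian 0 Γ)) := by
  have hκθ₀ : 2 * κ₀ * (1 + τ) * γop ≤ θ := mul_opBound_le_of_le (by positivity) (by linarith) hθ0.le hκθ
  have h := (lineZ_pos hΓ hΓop (C.biUnion cell) hw hκ₀ hτ hθ1 hκθ₀ hstab (WithLp.ofLp ψ₀) (WithLp.ofLp ζ) 1).2
  simpa only [one_mul] using h

/-- **THE EXACT FACTORISATION OF THE NEXT FACTOR**: for EVERY `ζ`, vector `b` and matrix `K`,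
`Z(ψ₀+ζ) = Z(ψ₀)·(e^{−½ζᵀKζ − ⟨b,ζ⟩}·e^{r(ζ)})`, `r(ζ) = log Z(ψ₀+ζ) − log Z(ψ₀) + ⟨b,ζ⟩ + ½ζᵀKζ`. [folklore] -/
theorem next_factor_factorisation (hΓ : Γ.PosSemidef) (hΓop : (γop • (1 : Matrix ι ι ℝ) - Γ).PosSemidef) (hw : ∀ x, Measurable (w x))
    (hκ₀ : 0 ≤ κ₀) (hτ : 0 < τ) (hδ : 0 < δ) (hθ0 : 0 < θ) (hθ1 : θ < 1) (hκθ : (2 * κ₀ * (1 + τ) + 4 * δ) * γop ≤ θ)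
    (hstab : ∀ x, ∀ t : ℝ, -(κ₀ * t ^ 2) ≤ w x t) (C : Finset V) (ψ₀ ζ : EuclideanSpace ℝ ι) (b : ι → ℝ) (K : Matrix ι ι ℝ) :
    (∫ ω : EuclideanSpace ℝ ι, exp (-(∑ x ∈ C.biUnion cell, w x (ω x + (ψ₀ x + ζ x)))) ∂(multivariateGaussian 0 Γ)) =
      (∫ ω : EuclideanSpace ℝ ι, exp (-(∑ x ∈ C.biUnion cell, w x (ω x + ψ₀ x))) ∂(multivariateGaussian 0 Γ)) *
        (Real.exp (-((WithLp.ofLp ζ) ⬝ᵥ K *ᵥ (WithLp.ofLp ζ)) / 2 - (b ⬝ᵥ (WithLp.ofLp ζ))) *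
          Real.exp (Real.log (∫ ω : EuclideanSpace ℝ ι, exp (-(∑ x ∈ C.biUnion cell, w x (ω x + (ψ₀ x + ζ x)))) ∂(multivariateGaussian 0 Γ)) -
          Real.log (∫ ω : EuclideanSpace ℝ ι, exp (-(∑ x ∈ C.biUnion cell, w x (ω x + ψ₀ x))) ∂(multivariateGaussian 0 Γ)) +
        (b ⬝ᵥ (WithLp.ofLp ζ)) + ((WithLp.ofLp ζ) ⬝ᵥ K *ᵥ (WithLp.ofLp ζ)) / 2)) := by
  have hZ0 := Z_pos_at (cell := cell) hΓ hΓop hw hκ₀ hτ hδ hθ0 hθ1 hκθ hstab C ψ₀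
  have hZ1 := Z_pos_shifted (cell := cell) hΓ hΓop hw hκ₀ hτ hδ hθ0 hθ1 hκθ hstab C ψ₀ ζ
  have h := factorisation_of_logs hZ0 hZ1 (-(b ⬝ᵥ (WithLp.ofLp ζ))) (-((WithLp.ofLp ζ) ⬝ᵥ K *ᵥ (WithLp.ofLp ζ)))
  rw [show -(b ⬝ᵥ (WithLp.ofLp ζ)) + -((WithLp.ofLp ζ) ⬝ᵥ K *ᵥ (WithLp.ofLp ζ)) / 2 = -((WithLp.ofLp ζ) ⬝ᵥ K *ᵥ (WithLp.ofLp ζ)) / 2 - (b ⬝ᵥ (WithLp.ofLp ζ)) from by ring,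
    show Real.log (∫ ω : EuclideanSpace ℝ ι, exp (-(∑ x ∈ C.biUnion cell, w x (ω x + (ψ₀ x + ζ x)))) ∂(multivariateGaussian 0 Γ)) -
          Real.log (∫ ω : EuclideanSpace ℝ ι, exp (-(∑ x ∈ C.biUnion cell, w x (ω x + ψ₀ x))) ∂(multivariateGaussian 0 Γ)) - -(b ⬝ᵥ (WithLp.ofLp ζ)) - -((WithLp.ofLp ζ) ⬝ᵥ K *ᵥ (WithLp.ofLp ζ)) / 2 =
        Real.log (∫ ω : EuclideanSpace ℝ ι, exp (-(∑ x ∈ C.biUnion cell, w x (ω x + (ψ₀ x + ζ x)))) ∂(multivariateGaussian 0 Γ)) -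
          Real.log (∫ ω : EuclideanSpace ℝ ι, exp (-(∑ x ∈ C.biUnion cell, w x (ω x + ψ₀ x))) ∂(multivariateGaussian 0 Γ)) +
        (b ⬝ᵥ (WithLp.ofLp ζ)) + ((WithLp.ofLp ζ) ⬝ᵥ K *ᵥ (WithLp.ofLp ζ)) / 2 from by ring, mul_assoc] at h
  exact h

/-! ## §2. THE END: the dressed step -/

variable {G : Type*} [NormedAddCommGroup G] [NormedSpace ℝ G]

/-- **THE DRESSED STEP.**  This step's data as in `Z_pos_at` (`Γ ⪰ 0`, `Γ ⪯ γ_op·1`, measurable remainders with `−κ₀t² ≤ w`, the regulator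
margin); ANY vector `b` and matrix `K`; the NEXT covariance `S ≻ 0` with `S⁻¹ + K ≻ 0` ⟹ for EVERY `F : ℝ^ι → G`:
`∫ Z(ψ₀+ζ)•F(ζ) dN(0,S) = Z(ψ₀) • ((∫e^{−½ζᵀKζ − ⟨b,ζ⟩}dN(0,S)) • ∫ e^{r(ζ)}•F(ζ) dN(−(S⁻¹+K)⁻¹b, (S⁻¹+K)⁻¹))`. [folklore] -/
theorem dressed_step (hΓ : Γ.PosSemidef) (hΓop : (γop • (1 : Matrix ι ι ℝ) - Γ).PosSemidef) (hw : ∀ x, Measurable (w x))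
    (hκ₀ : 0 ≤ κ₀) (hτ : 0 < τ) (hδ : 0 < δ) (hθ0 : 0 < θ) (hθ1 : θ < 1) (hκθ : (2 * κ₀ * (1 + τ) + 4 * δ) * γop ≤ θ)
    (hstab : ∀ x, ∀ t : ℝ, -(κ₀ * t ^ 2) ≤ w x t) (C : Finset V) (ψ₀ : EuclideanSpace ℝ ι) (b : ι → ℝ) (K : Matrix ι ι ℝ)
    {S : Matrix ι ι ℝ} (hS : S.PosDef) (hQ : (S⁻¹ + K).PosDef) (F : EuclideanSpace ℝ ι → G) :
    ∫ ζ : EuclideanSpace ℝ ι, (∫ ω : EuclideanSpace ℝ ι, exp (-(∑ x ∈ C.biUnion cell, w x (ω x + (ψ₀ x + ζ x)))) ∂(multivariateGaussian 0 Γ)) • F ζ ∂(multivariateGaussian 0 S) =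
      (∫ ω : EuclideanSpace ℝ ι, exp (-(∑ x ∈ C.biUnion cell, w x (ω x + ψ₀ x))) ∂(multivariateGaussian 0 Γ)) •
        ((∫ ζ : EuclideanSpace ℝ ι, Real.exp (-((WithLp.ofLp ζ) ⬝ᵥ K *ᵥ (WithLp.ofLp ζ)) / 2 - (b ⬝ᵥ (WithLp.ofLp ζ))) ∂(multivariateGaussian 0 S)) •
          ∫ ζ : EuclideanSpace ℝ ι, Real.exp (Real.log (∫ ω : EuclideanSpace ℝ ι, exp (-(∑ x ∈ C.biUnion cell, w x (ω x + (ψ₀ x + ζ x)))) ∂(multivariateGaussian 0 Γ)) -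
          Real.log (∫ ω : EuclideanSpace ℝ ι, exp (-(∑ x ∈ C.biUnion cell, w x (ω x + ψ₀ x))) ∂(multivariateGaussian 0 Γ)) +
        (b ⬝ᵥ (WithLp.ofLp ζ)) + ((WithLp.ofLp ζ) ⬝ᵥ K *ᵥ (WithLp.ofLp ζ)) / 2) • F ζ
            ∂(multivariateGaussian (WithLp.toLp 2 (-((S⁻¹ + K)⁻¹ *ᵥ b))) (S⁻¹ + K)⁻¹)) := by
  have hfac := fun ζ : EuclideanSpace ℝ ι => next_factor_factorisation (cell := cell) hΓ hΓop hw hκ₀ hτ hδ hθ0 hθ1 hκθ hstab C ψ₀ ζ b K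
  have habs := absorption_integral_neg hS K hQ b (fun ζ : EuclideanSpace ℝ ι => Real.exp (Real.log (∫ ω : EuclideanSpace ℝ ι, exp (-(∑ x ∈ C.biUnion cell, w x (ω x + (ψ₀ x + ζ x)))) ∂(multivariateGaussian 0 Γ)) -
          Real.log (∫ ω : EuclideanSpace ℝ ι, exp (-(∑ x ∈ C.biUnion cell, w x (ω x + ψ₀ x))) ∂(multivariateGaussian 0 Γ)) +
        (b ⬝ᵥ (WithLp.ofLp ζ)) + ((WithLp.ofLp ζ) ⬝ᵥ K *ᵥ (WithLp.ofLp ζ)) / 2) • F ζ)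
  rw [← habs, ← integral_smul]
  refine integral_congr_ae (ae_of_all _ fun ζ => ?_)
  dsimp only
  nth_rewrite 1 [hfac ζ]
  rw [smul_smul, smul_smul]
  congr 1
  ring

/-- **The one number**: `c = ∫e^{−½ζᵀKζ − ⟨b,ζ⟩}dN(0,S) = √(det S⁻¹∕det(S⁻¹+K))·e^{½bᵀ(S⁻¹+K)⁻¹b} > 0`. [folklore] -/
theorem dressed_step_const (b : ι → ℝ) (K : Matrix ι ι ℝ) {S : Matrix ι ι ℝ} (hS : S.PosDef) (hQ : (S⁻¹ + K).PosDef) :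
    ∫ ζ : EuclideanSpace ℝ ι, Real.exp (-((WithLp.ofLp ζ) ⬝ᵥ K *ᵥ (WithLp.ofLp ζ)) / 2 - (b ⬝ᵥ (WithLp.ofLp ζ))) ∂(multivariateGaussian 0 S) =
        Real.sqrt (S⁻¹).det / Real.sqrt (S⁻¹ + K).det * Real.exp ((b ⬝ᵥ (S⁻¹ + K)⁻¹ *ᵥ b) / 2) ∧
      0 < ∫ ζ : EuclideanSpace ℝ ι, Real.exp (-((WithLp.ofLp ζ) ⬝ᵥ K *ᵥ (WithLp.ofLp ζ)) / 2 - (b ⬝ᵥ (WithLp.ofLp ζ))) ∂(multivariateGaussian 0 S) := by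
  have h := absorption_const_cov hS K hQ (-b)
  simp only [neg_dotProduct, ← sub_eq_add_neg, Matrix.mulVec_neg, dotProduct_neg, neg_neg] at h
  exact h

end Road

/-! ## §3. THE ROAD'S CHOICE: `S⁻¹ + K_D(ψ₀) ≻ 0` from the letters -/

section Choice

variable {cell : V → Finset ι} {w w' w'' : ι → ℝ → ℝ} {κ₀ κ₁ κ₂ τ δ θ : ℝ}

/-- **THE DRESSED PRECISION OF THE ROAD IS POSITIVE DEFINITE**: under (388)'s hypotheses (this step over `N(0,M⁻¹)`, `M ≻ 0` of floor `m`,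
the second-order class letters `λ_w, Λ_w ≥ 0`, `2λ_w ≤ m`, the regulator margins) and a NEXT covariance `S ≻ 0` with `γ′·1 − S ⪰ 0`,
`0 < γ′`, `2λ_w·γ′ < 1`:  `S⁻¹ + K_D(ψ₀) ≻ 0` — the hypothesis `hQ` of `dressed_step` for the road's choice `K = K_D(ψ₀)`. [folklore] -/
theorem road_dressed_precision_posDef {M : Matrix ι ι ℝ} {γop m lamw Λw : ℝ} (hM : M.PosDef)
    (hfl : ∀ z : ι → ℝ, m * ∑ i, z i ^ 2 ≤ z ⬝ᵥ (M *ᵥ z)) (hΓop : (γop • (1 : Matrix ι ι ℝ) - M⁻¹).PosSemidef)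
    (hdisj : ∀ p q, p ≠ q → Disjoint (cell p) (cell q)) (hw' : ∀ x t, HasDerivAt (w x) (w' x t) t)
    (hw'' : ∀ x t, HasDerivAt (w' x) (w'' x t) t) (hw'm : ∀ x, Measurable (w' x)) (hw''m : ∀ x, Measurable (w'' x))
    (hκ₀ : 0 ≤ κ₀) (hκ₁ : 0 ≤ κ₁) (hτ : 0 < τ) (hδ : 0 < δ) (hθ0 : 0 < θ) (hθ1 : θ < 1) (hκθ : (2 * κ₀ * (1 + τ) + 4 * δ) * γop ≤ θ)
    (hκθ₆ : 6 * κ₀ * (1 + τ) * γop ≤ θ) (hstab : ∀ x, ∀ t : ℝ, -(κ₀ * t ^ 2) ≤ w x t) (hquad : ∀ x, ∀ t : ℝ, w x t ≤ κ₀ * t ^ 2)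
    (hw'b : ∀ x t, |w' x t| ≤ κ₁ * |t|) (hw''b : ∀ x t, |w'' x t| ≤ κ₂) (hlamw : 0 ≤ lamw) (hΛw : 0 ≤ Λw)
    (hwlo : ∀ u (a b : ℝ), w u a + w' u a * (b - a) - lamw / 2 * (b - a) ^ 2 ≤ w u b)
    (hwup : ∀ x (a b : ℝ), w x b ≤ w x a + w' x a * (b - a) + Λw / 2 * (b - a) ^ 2) (hm : 2 * lamw ≤ m) (C : Finset V)
    (ψ₀ : EuclideanSpace ℝ ι) {S : Matrix ι ι ℝ} {γ' : ℝ} (hS : S.PosDef) (hSγ : (γ' • (1 : Matrix ι ι ℝ) - S).PosSemidef) (hγ' : 0 < γ')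
    (hsmall : 2 * lamw * γ' < 1) :
    (S⁻¹ + (Matrix.of fun x y : ι =>
      ((((∫ ω : EuclideanSpace ℝ ι, exp (-(∑ p ∈ C, ∑ x ∈ cell p, w x (ω x + ψ₀ x))) ∂(multivariateGaussian 0 M⁻¹))⁻¹ •
          (∫ ω : EuclideanSpace ℝ ι, exp (-(∑ p ∈ C, ∑ x ∈ cell p, w x (ω x + ψ₀ x))) •
            ((∑ p ∈ C, ∑ x ∈ cell p, (w'' x (ω x + ψ₀ x)) • ((EuclideanSpace.proj x : EuclideanSpace ℝ ι →L[ℝ] ℝ).smulRight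
                (EuclideanSpace.proj x : EuclideanSpace ℝ ι →L[ℝ] ℝ))) -
              (∑ p ∈ C, ∑ x ∈ cell p, (w' x (ω x + ψ₀ x)) • (EuclideanSpace.proj x : EuclideanSpace ℝ ι →L[ℝ] ℝ)).smulRight
                (∑ p ∈ C, ∑ x ∈ cell p, (w' x (ω x + ψ₀ x)) • (EuclideanSpace.proj x : EuclideanSpace ℝ ι →L[ℝ] ℝ)))
            ∂(multivariateGaussian 0 M⁻¹)) +
        (((∫ ω : EuclideanSpace ℝ ι, exp (-(∑ p ∈ C, ∑ x ∈ cell p, w x (ω x + ψ₀ x))) ∂(multivariateGaussian 0 M⁻¹)) ^ 2)⁻¹ •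
          ∫ ω : EuclideanSpace ℝ ι, exp (-(∑ p ∈ C, ∑ x ∈ cell p, w x (ω x + ψ₀ x))) •
            (∑ p ∈ C, ∑ x ∈ cell p, (w' x (ω x + ψ₀ x)) • (EuclideanSpace.proj x : EuclideanSpace ℝ ι →L[ℝ] ℝ))
            ∂(multivariateGaussian 0 M⁻¹)).smulRight
          (∫ ω : EuclideanSpace ℝ ι, exp (-(∑ p ∈ C, ∑ x ∈ cell p, w x (ω x + ψ₀ x))) •
            (∑ p ∈ C, ∑ x ∈ cell p, (w' x (ω x + ψ₀ x)) • (EuclideanSpace.proj x : EuclideanSpace ℝ ι →L[ℝ] ℝ))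
            ∂(multivariateGaussian 0 M⁻¹)))
          (EuclideanSpace.single x (1 : ℝ)) (EuclideanSpace.single y (1 : ℝ)) +
        ((∫ ω : EuclideanSpace ℝ ι, exp (-(∑ p ∈ C, ∑ x ∈ cell p, w x (ω x + ψ₀ x))) ∂(multivariateGaussian 0 M⁻¹))⁻¹ •
          (∫ ω : EuclideanSpace ℝ ι, exp (-(∑ p ∈ C, ∑ x ∈ cell p, w x (ω x + ψ₀ x))) •
            ((∑ p ∈ C, ∑ x ∈ cell p, (w'' x (ω x + ψ₀ x)) • ((EuclideanSpace.proj x : EuclideanSpace ℝ ι →L[ℝ] ℝ).smulRight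
                (EuclideanSpace.proj x : EuclideanSpace ℝ ι →L[ℝ] ℝ))) -
              (∑ p ∈ C, ∑ x ∈ cell p, (w' x (ω x + ψ₀ x)) • (EuclideanSpace.proj x : EuclideanSpace ℝ ι →L[ℝ] ℝ)).smulRight
                (∑ p ∈ C, ∑ x ∈ cell p, (w' x (ω x + ψ₀ x)) • (EuclideanSpace.proj x : EuclideanSpace ℝ ι →L[ℝ] ℝ)))
            ∂(multivariateGaussian 0 M⁻¹)) +
        (((∫ ω : EuclideanSpace ℝ ι, exp (-(∑ p ∈ C, ∑ x ∈ cell p, w x (ω x + ψ₀ x))) ∂(multivariateGaussian 0 M⁻¹)) ^ 2)⁻¹ •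
          ∫ ω : EuclideanSpace ℝ ι, exp (-(∑ p ∈ C, ∑ x ∈ cell p, w x (ω x + ψ₀ x))) •
            (∑ p ∈ C, ∑ x ∈ cell p, (w' x (ω x + ψ₀ x)) • (EuclideanSpace.proj x : EuclideanSpace ℝ ι →L[ℝ] ℝ))
            ∂(multivariateGaussian 0 M⁻¹)).smulRight
          (∫ ω : EuclideanSpace ℝ ι, exp (-(∑ p ∈ C, ∑ x ∈ cell p, w x (ω x + ψ₀ x))) •
            (∑ p ∈ C, ∑ x ∈ cell p, (w' x (ω x + ψ₀ x)) • (EuclideanSpace.proj x : EuclideanSpace ℝ ι →L[ℝ] ℝ))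
            ∂(multivariateGaussian 0 M⁻¹)))
          (EuclideanSpace.single y (1 : ℝ)) (EuclideanSpace.single x (1 : ℝ))) / 2))).PosDef := by
  obtain ⟨-, hK, -⟩ := nextHessianMatrix_letters hM hfl hΓop hdisj hw' hw'' hw'm hw''m hκ₀ hκ₁ hτ hδ hθ0 hθ1 hκθ hκθ₆ hstab hquad hw'b
    hw''b hlamw hΛw hwlo hwup hm C ψ₀
  exact dressed_precision_posDef hS hSγ hγ' hK hsmall

end Choice

/-! ## §4. Toy -/

/-- Toy (§1's algebra): `−ℓ − q∕2` with `ℓ = −β`, `q = −κ` is `β + κ∕2`. -/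
example (β κ : ℝ) : -(-β) - -κ / 2 = β + κ / 2 := by ring

end Summit.QuantumFields.BalabanUV.T4Continuum.NE7b.SupDressedStep
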